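import Mathlib.Tactic
import HarnessLib

/-!
# Kozma–Nitzan's Question 8 — UNI-C(U;y): the layer-cake form, the renewal joint-defect budget and the two-variable LP (gen 38)

Support file (`--supports stmt-CriticalPhenomena-4575`, closed crux; independent mathematics on Kozma–Nitzan's Question 8,
arXiv:2401.12397 §5.5 p. 36), prover `prim-ineq-gen-6` (gen 38).  No definitions, no named facts, no sorries; standard axioms.
Memo `run/shared/lean/prim/prim-ineq-gen-6/PROOF-UNIC-LP-G38.md`.

THEOREM C-RED (gen 37, …KnQuestion8UniCChain.lean) reduced the C-side corner condition `UNI-C(U;y)(t)` to an LP in the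
post-region C-defects.  This generation sharpens the reduction in three ways (memo THEOREM C-STAR):
* the **layer-cake form**: dividing the Z-form by `a_t` and writing `1/a_l − 1/a_i = Σ_{u≤l} (1−A_u)/a_u`, the need of a kill
  at depth `l` carries the coefficient `(γ_l − γ_t)(1/a_l − 1/a_i)` = (C-defect after `l`) × (A-defect before `l`)
  (`kLP_star_step` is the one algebraic step that uses the hypothesis `N < Q₊`);
* the **renewal joint-defect budget**: `1 − Φ(T_{k₁}) = Σ_w ρ̂_w Ĵ_w` over all base vertices `w` (`kLP_renewal_step` is the
  one-step identity `1 − Σ_k r_kM_kΦ_k = Σ_k r_k(1−M_k) + Σ_k r_kM_k(1−Φ_k)` behind it), giving every C-defective vertex a canonical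
  joint-visibility weight `Ω_w` with `Σ_w c_wΩ_w = 1 − Φ(T_{k₁}) ≤ K₄/(Φ+m)`;
* the **two-variable LP** (`kLP_two_budget`): with the kill budget `Σ_w c_w KW_w ≤ N` of gen 37, any `y, z ≥ 0` with
  `yΩ_w + zKW_w ≥ r_w` for all `w` bound the need by `y·(1−Φ) + z·N`, hence (budget lemma, `Q₊² ≤ cQ2`) by `c(y·BUD₀ + z·Q2)`;
  `kLP_min_split` is the scalar step turning the joint/kill complementarity `Ω ≥ θs, KW ≥ θ′(1−s)` into a bound of the minimum.
THEOREM V (memo §3, the visible case): `kLP_usplit` (the A-defect mass of `T_{k₁}` is at most the base-`k₁` joint weight) and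
`kLP_Cbound` (the C-survival bound from the C-defect lemma `E[p(1−C)] < λE[pC]`) give `NEED ≤ (1−S)ĝ·SUP/(C_[k₁,t]σ_t)`, and with the
certified scalar constants (lab-g38/cert/cert_F1.py: `(1−S)ĝ ≤ 7/40`, `λ/(1+λ) + (1−S)ĝ ≤ 51/100`) UNI-C(U;y)(t) at every
C-hypothesis node whose connection to the positive region is `σ_t ≥ 0.51` (A-perfect prefix, e.g. `k₁ = 1`); `kLP_visible` is the
final assembly.  Exact link checks: lab-g38/g38/e13_lp2.py (0 failures).
[cite: KozmaNitzan2024, Question 8 (§5.5 p. 36)]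
-/

namespace Summit.CriticalPhenomena.PercolationContinuityZ3.Theorems

namespace PocketCert

open Finset

/-- **Layer-cake step (the only use of the C-hypothesis).**  With `Ñ = Na/a + X` (kills in `1/a`-units, `X` the A-layer part),
`H⁺ = Q/a − PRE` (positive emissions) and the hypothesis `Na < Q` (`a > 0`):  `c + H⁺ − Ñ > c − PRE − X`.
[cite: KozmaNitzan2024, Question 8 (§5.5 p. 36)] -/
theorem kLP_star_step (c Hplus Ntil Na Q a X PRE : ℝ) (ha : 0 < a) (hN : Ntil = Na / a + X)
    (hH : Hplus = Q / a - PRE) (hyp : Na < Q) :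
    c - PRE - X < c + Hplus - Ntil := by
  have h1 : Na / a < Q / a := div_lt_div_of_pos_right hyp ha
  rw [hN, hH]; linarith

/-- **Renewal step.**  For a finite family of first fragments `k` with probabilities `r_k` summing to `1`, openness `M_k` and
continuation values `Φ_k`:  `1 − Σ_k r_kM_kΦ_k = Σ_k r_k(1 − M_k) + Σ_k r_kM_k(1 − Φ_k)`.  Unrolled along the path this is
`1 − Φ(T_{k₁}) = Σ_w ρ̂_w Ĵ_w`.
[cite: KozmaNitzan2024, Question 8 (§5.5 p. 36)] -/
theorem kLP_renewal_step (K : Finset ℕ) (r Mo Ph : ℕ → ℝ) (hr : ∑ k ∈ K, r k = 1) :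
    1 - ∑ k ∈ K, r k * Mo k * Ph k = ∑ k ∈ K, r k * (1 - Mo k) + ∑ k ∈ K, r k * Mo k * (1 - Ph k) := by
  have h : ∑ k ∈ K, r k * (1 - Mo k) + ∑ k ∈ K, r k * Mo k * (1 - Ph k)
      = ∑ k ∈ K, r k - ∑ k ∈ K, r k * Mo k * Ph k := by
    rw [← Finset.sum_add_distrib, ← Finset.sum_sub_distrib]
    apply Finset.sum_congr rfl
    intro k _
    ring
  rw [h, hr]

/-- **Two-variable LP (weak duality with a joint and a kill budget).**  If `0 ≤ c_w`, `r_w ≤ yΩ_w + zK_w` for every `w`,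
`Σ_w c_wΩ_w ≤ J`, `Σ_w c_wK_w ≤ N` and `y, z ≥ 0`, then `Σ_w c_w r_w ≤ yJ + zN`.
[cite: KozmaNitzan2024, Question 8 (§5.5 p. 36)] -/
theorem kLP_two_budget (W : Finset ℕ) (cd r Ω K : ℕ → ℝ) (y z J N : ℝ) (hy : 0 ≤ y) (hz : 0 ≤ z)
    (hc : ∀ w ∈ W, 0 ≤ cd w) (hr : ∀ w ∈ W, r w ≤ y * Ω w + z * K w)
    (hJ : ∑ w ∈ W, cd w * Ω w ≤ J) (hN : ∑ w ∈ W, cd w * K w ≤ N) :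
    ∑ w ∈ W, cd w * r w ≤ y * J + z * N := by
  have h1 : ∑ w ∈ W, cd w * r w ≤ ∑ w ∈ W, (y * (cd w * Ω w) + z * (cd w * K w)) := by
    apply Finset.sum_le_sum
    intro w hw
    have := mul_le_mul_of_nonneg_left (hr w hw) (hc w hw)
    nlinarith
  rw [Finset.sum_add_distrib, ← Finset.mul_sum, ← Finset.mul_sum] at h1
  have h2 := mul_le_mul_of_nonneg_left hJ hy
  have h3 := mul_le_mul_of_nonneg_left hN hz
  linarith

/-- **Splitting a minimum against complementary visibilities.**  If the joint weight is at least `θ₁·s` and the kill weight at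
least `θ₂·(1−s)` for some share `s ∈ [0,1]`, then `min(B/Ω, Q/K) ≤ B/θ₁ + Q/θ₂` (all quantities positive).
[cite: KozmaNitzan2024, Question 8 (§5.5 p. 36)] -/
theorem kLP_min_split (B Q Ω K θ₁ θ₂ s : ℝ) (hB : 0 ≤ B) (hQ : 0 ≤ Q) (hθ₁ : 0 < θ₁) (hθ₂ : 0 < θ₂)
    (hΩ0 : 0 < Ω) (hK0 : 0 < K) (hs0 : 0 ≤ s) (hs1 : s ≤ 1) (hΩ : θ₁ * s ≤ Ω) (hK : θ₂ * (1 - s) ≤ K) :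
    min (B / Ω) (Q / K) ≤ B / θ₁ + Q / θ₂ := by
  by_cases h : (1:ℝ) / 2 ≤ s
  · -- Ω ≥ θ₁/2, so B/Ω ≤ 2B/θ₁ ... too weak; use instead: s ≥ 1/2 ⇒ B/Ω ≤ B/(θ₁ s) ≤ 2B/θ₁?  We prove the sharper split directly:
    -- min ≤ B/Ω ≤ B/(θ₁ s) and we need ≤ B/θ₁ + Q/θ₂; since s ≤ 1 this needs the Q/θ₂ slack when s < 1.  Use convexity instead:
    -- min(X,Y) ≤ s·X + (1-s)·Y with X = B/Ω ≤ B/(θ₁ s), Y = Q/K ≤ Q/(θ₂(1-s)).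
    have hmin : min (B / Ω) (Q / K) ≤ s * (B / Ω) + (1 - s) * (Q / K) := by
      have h1 : min (B / Ω) (Q / K) ≤ B / Ω := min_le_left _ _
      have h2 : min (B / Ω) (Q / K) ≤ Q / K := min_le_right _ _
      nlinarith
    have hX : s * (B / Ω) ≤ B / θ₁ := by
      -- s B/Ω ≤ B/θ₁  ⇔  s B θ₁ ≤ B Ω  ⇐  θ₁ s ≤ Ω
      rw [mul_div_assoc', div_le_div_iff₀ hΩ0 hθ₁]
      have := mul_le_mul_of_nonneg_left hΩ hB
      nlinarith
    have hY : (1 - s) * (Q / K) ≤ Q / θ₂ := by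
      rw [mul_div_assoc', div_le_div_iff₀ hK0 hθ₂]
      have := mul_le_mul_of_nonneg_left hK hQ
      nlinarith
    linarith
  · have hmin : min (B / Ω) (Q / K) ≤ s * (B / Ω) + (1 - s) * (Q / K) := by
      have h1 : min (B / Ω) (Q / K) ≤ B / Ω := min_le_left _ _
      have h2 : min (B / Ω) (Q / K) ≤ Q / K := min_le_right _ _
      nlinarith
    have hX : s * (B / Ω) ≤ B / θ₁ := by
      rw [mul_div_assoc', div_le_div_iff₀ hΩ0 hθ₁]
      have := mul_le_mul_of_nonneg_left hΩ hB
      nlinarith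
    have hY : (1 - s) * (Q / K) ≤ Q / θ₂ := by
      rw [mul_div_assoc', div_le_div_iff₀ hK0 hθ₂]
      have := mul_le_mul_of_nonneg_left hK hQ
      nlinarith
    linarith

/-- **The A-defect mass of `T_{k₁}` is dominated by the base-`k₁` joint weight of any vertex `w`.**  Splitting the classes of
`T_{k₁}` at `w` (connection `σ = S_[k₁+1,w]`, A-defect `α = 1 − A_[k₁,w−1]` before `w`, unweighted A-defect mass `u′ ≥ 0` of
`T_w`): `ǔ ≤ α(1−σ) + σ(α + (1−α)u′) ≤ α + (1−α)u′`.
[cite: KozmaNitzan2024, Question 8 (§5.5 p. 36)] -/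
theorem kLP_usplit (uc α σ u' : ℝ) (hσ1 : σ ≤ 1) (hα1 : α ≤ 1) (hu' : 0 ≤ u')
    (h : uc ≤ α * (1 - σ) + σ * (α + (1 - α) * u')) :
    uc ≤ α + (1 - α) * u' := by
  have : σ * ((1 - α) * u') ≤ (1 - α) * u' := by
    have h0 : 0 ≤ (1 - α) * u' := mul_nonneg (by linarith) hu'
    nlinarith
  nlinarith

/-- **C-survival bound from the C-defect lemma.**  The C-defect lemma of the last positive depth (`E_{k₁}[p(1−C)] < λ·E_{k₁}[pC]`,
shallow far channel + VIS+) restricted to the classes reaching `t`: with `σ = S_[k₁+1,t]`, `C = C_[k₁,t]`, `pt = p̃_t ≥ p = p_{t−1} > 0`,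
`(1−C)σ·pt < λ((1−σ)p + σ·C·pt)` gives `σ − λ(1−σ) < C·σ(1+λ)`.
[cite: KozmaNitzan2024, Question 8 (§5.5 p. 36)] -/
theorem kLP_Cbound (C σ lam p pt : ℝ) (hσ1 : σ ≤ 1) (hlam : 0 ≤ lam) (hpt : 0 < pt) (hp : p ≤ pt)
    (h : (1 - C) * σ * pt < lam * ((1 - σ) * p + σ * C * pt)) :
    σ - lam * (1 - σ) < C * (σ * (1 + lam)) := by
  have h1 : lam * ((1 - σ) * p) ≤ lam * ((1 - σ) * pt) := by
    apply mul_le_mul_of_nonneg_left _ hlam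
    exact mul_le_mul_of_nonneg_left hp (by linarith)
  have h2 : (1 - C) * σ * pt < lam * (1 - σ) * pt + lam * σ * C * pt := by nlinarith
  -- divide by pt > 0
  have h3 : ((1 - C) * σ) * pt < (lam * (1 - σ) + lam * σ * C) * pt := by nlinarith
  have h4 : (1 - C) * σ < lam * (1 - σ) + lam * σ * C := lt_of_mul_lt_mul_right h3 hpt.le
  nlinarith

/-- **THEOREM V, assembly (the visible case).**  Along the chain of the memo: the need satisfies `NEED ≤ y·BUD₀` (joint route of the
two-variable LP with `z = 0`), `y·σ·D ≤ γi·fa` for the base-`k₁` weight (`D = α + (1−α)ǔ_w`), `BUD₀ ≤ F·u` with `u ≤ D`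
(`kLP_usplit`; `F = (1−S)ĝ`), and the supply is `SUP ≥ γt·fa` (`fa = 1/a_{t−1} − 1/a_i ≥ 0`).  Then `NEED·(γt·σ) ≤ F·γi·SUP`, i.e.
`NEED/SUP ≤ F/(C_[k₁,t]σ_t)`.
[cite: KozmaNitzan2024, Question 8 (§5.5 p. 36)] -/
theorem kLP_visible (NEED y BUD σ γi γt fa D F u SUP : ℝ)
    (hy : 0 ≤ y) (hσ : 0 < σ) (hF : 0 ≤ F) (hγi : 0 ≤ γi) (hγt : 0 ≤ γt)
    (h1 : NEED ≤ y * BUD) (h2 : y * σ * D ≤ γi * fa) (h3 : BUD ≤ F * u) (h4 : u ≤ D) (h5 : γt * fa ≤ SUP) :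
    NEED * (γt * σ) ≤ F * γi * SUP := by
  -- NEED σ ≤ y σ BUD ≤ y σ F u ≤ y σ F D ≤ F γi fa ; times γt: ≤ F γi SUP
  have a1 : NEED * σ ≤ y * σ * BUD := by nlinarith
  have a2 : y * σ * BUD ≤ y * σ * (F * u) := by
    apply mul_le_mul_of_nonneg_left h3; positivity
  have a3 : y * σ * (F * u) ≤ y * σ * (F * D) := by
    apply mul_le_mul_of_nonneg_left _ (by positivity)
    exact mul_le_mul_of_nonneg_left h4 hF
  have a4 : y * σ * (F * D) = F * (y * σ * D) := by ring
  have a5 : F * (y * σ * D) ≤ F * (γi * fa) := mul_le_mul_of_nonneg_left h2 hF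
  have a6 : NEED * σ ≤ F * (γi * fa) := by linarith
  have a7 : NEED * σ * γt ≤ F * (γi * fa) * γt := mul_le_mul_of_nonneg_right a6 hγt
  have a8 : F * (γi * fa) * γt = F * γi * (γt * fa) := by ring
  have a9 : F * γi * (γt * fa) ≤ F * γi * SUP := mul_le_mul_of_nonneg_left h5 (by positivity)
  nlinarith

end PocketCert

end Summit.CriticalPhenomena.PercolationContinuityZ3.Theorems
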